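import Mathlib
import HarnessLib
import Literature.Analysis.FluidPDE.SuitableWeak
import Literature.Analysis.FluidPDE.SelfSimilar
import Literature.Analysis.FluidPDE.LocalTypeI
import Literature.Analysis.FluidPDE.WeakSolutionProofs
import Literature.Analysis.FluidPDE.IsometryInvariance
import Literature.Analysis.FluidPDE.Seregin2020SingularSetAxis
import Literature.Analysis.FluidPDE.AxisymmetricEuler
import Literature.Analysis.FluidPDE.AxisymmetricVorticityTransport
import Summits.NavierStokesRegularity.NavierStokesRegularity.Theses.RellichScar
import Summits.NavierStokesRegularity.NavierStokesRegularity.Theorems.RellichScarSimilarityCovarianceZoom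
import Summits.NavierStokesRegularity.NavierStokesRegularity.Theorems.RellichScarSimilarityCovarianceRotationWeak
import Summits.NavierStokesRegularity.NavierStokesRegularity.Theorems.RellichScarSimilarityCovarianceRotationAB

/-!
# `RellichScar.SimilarityCovariance` (item stmt-NavierStokesRegularity-11720): rotation
# covariance of the suitable weak class on a slab, and assembly

The apex class of route RellichScar — suitable weak solutions `(u, p)` of Navier–Stokes
(`ν = 1`, `f = 0`) on the slab `ℝ³ × (−∞, 0)` with a weak spatial gradient `G`,
Albritton–Barker quantity `𝐈(ℝ³ × ℝ₋) < ∞` and the space–time Type-I bound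
`|u| ≤ C/(|x| + √−t)` — together with the backward singularity of the origin is covariant under
the Navier–Stokes rescaling about the origin (`RellichScarSimilarityCovarianceZoom.lean`) and
under the rotations `R_θ` about the `x₃`-axis, with the same constant `C`.

This file completes the rotation half and assembles the item:

* `isSuitableWeakSolutionOn_conj` — for a linear isometry `R : E ≃ₗᵢ[ℝ] E` and an open time set
  `I`, the CKN class of **suitable weak solutions** (Caffarelli–Kohn–Nirenberg 1982, (2.1)–(2.5);
  Lin 1998, Def. 1; tree structure `IsSuitableWeakSolutionOn`) on the slab `I × E` is covariant
  under `u ↦ R u(t, R⁻¹x)`, `p ↦ p(t, R⁻¹x)`, `f ↦ R f(t, R⁻¹x)`: the distributional equations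
  and the weak gradient `R ∘ ∇u(t, R⁻¹x) ∘ R⁻¹` are covariant (`isDistributionalNSSolutionOn_conj`,
  `hasWeakSpatialGradientOn_conj` of `…RotationWeak.lean`), the local classes `u ∈ L^∞_t L²_x`,
  `∇u ∈ L²`, `p ∈ L^{3/2}` on a compact `K` are those of `(u, p)` on the compact image of `K`
  under the measure-preserving map `(t, x) ↦ (t, R⁻¹x)`, and each term of the local energy
  inequality (2.5) tested with `φ ≥ 0` equals, after `x = R y` in the space integral, the
  corresponding term for `(u, p)` tested with `φ(t, R ·) ≥ 0` (`|R a| = |a|`,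
  `|R ∘ L ∘ R⁻¹|² = |L|²`, `Δ(φ ∘ R) = (Δφ) ∘ R`, `∇(φ ∘ R) = R⁻¹ (∇φ) ∘ R`) — the weak form of
  the rotation symmetry of the equations (Majda–Bertozzi 2002, Prop. 1.1 (iii); KNSS 2009, §1);
* `apexClass_conj` — with `LIE.typeIBound_lowerHalf_conj`, `LIE.hasTypeIDecay_conj`,
  `LIE.isBackwardSingularPoint_zero_conj` (`…RotationAB.lean`): the apex class and the origin
  singularity pass to `R u(t, R⁻¹x)`;
* `similarityCovariance_proof` — the item, from `Zoom.apexClass_nsRescale` (`…Zoom.lean`) and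
  `apexClass_conj` at `R = R_θ = rotZLIE θ`.

Sources: L. Caffarelli, R. Kohn, L. Nirenberg, CPAM 35 (1982), §2; G. Koch, N. Nadirashvili,
G. Seregin, V. Šverák, Acta Math. 203 (2009), §1; D. Albritton, T. Barker, JMFM 21 (2019), §3;
A. Majda, A. Bertozzi, *Vorticity and Incompressible Flow* (2002), §1.2 Prop. 1.1.
-/

-- the summit and its single sub-problem share the name (CONVENTIONS §1), as in every Theorems file
set_option linter.dupNamespace false

namespace Summit.NavierStokesRegularity.NavierStokesRegularity.Theorems.RellichScarSimilarityCovariance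

open MeasureTheory Set Function Metric Filter TopologicalSpace
open scoped ENNReal NNReal InnerProductSpace RealInnerProductSpace Laplacian
open Literature.Analysis Literature.Analysis.FluidPDE

section Suitable

variable {E : Type*} [NormedAddCommGroup E] [InnerProductSpace ℝ E] [FiniteDimensional ℝ E]
  [MeasurableSpace E] [BorelSpace E]

/-! ### Suitable weak solutions -/

omit [FiniteDimensional ℝ E] [MeasurableSpace E] [BorelSpace E] in
/-- Images of subsets of the slab under `Ψ(t, x) = (t, R x)` stay in the slab. -/
theorem image_prodMap_subset_slab (R : E ≃ₗᵢ[ℝ] E) {I : Set ℝ} {K : Set (ℝ × E)}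
    (hK : K ⊆ I ×ˢ (univ : Set E)) : Prod.map (id : ℝ → ℝ) R '' K ⊆ I ×ˢ (univ : Set E) := by
  rintro _ ⟨z, hz, rfl⟩
  simpa [mem_prod] using hK hz

/-- **Rotation covariance of suitable weak solutions on a slab** (Caffarelli–Kohn–Nirenberg
1982, (2.1)–(2.5); Majda–Bertozzi 2002, Prop. 1.1 (iii)): if `(u, p)` is a suitable weak solution
with force `f` and viscosity `ν` on `I × E`, then so is `(R u(t, R⁻¹x), p(t, R⁻¹x))` with force
`R f(t, R⁻¹x)`; the weak gradient becomes `R ∘ ∇u(t, R⁻¹x) ∘ R⁻¹`, the local classes are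
transported along the measure-preserving map `(t, x) ↦ (t, R⁻¹x)`, and the local energy
inequality tested with `φ ≥ 0` is the one for `(u, p)` tested with `φ(t, R ·)` after the
substitution `x = R y` in the space integrals. -/
theorem isSuitableWeakSolutionOn_conj {I : Set ℝ} {hI : IsOpen I} {ν : ℝ} {f u : ℝ → E → E}
    {p : ℝ → E → ℝ} (h : IsSuitableWeakSolutionOn (slab E I hI) ν f u p) (R : E ≃ₗᵢ[ℝ] E) :
    IsSuitableWeakSolutionOn (slab E I hI) ν (fun t x => R (f t (R.symm x)))
      (fun t x => R (u t (R.symm x))) (fun t x => p t (R.symm x)) := by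
  set Ψ : ℝ × E → ℝ × E := Prod.map (id : ℝ → ℝ) (R.symm : E → E) with hΨ
  have hΨmp : MeasurePreserving Ψ (volume : Measure (ℝ × E)) volume :=
    measurePreserving_prodMap_id_linearIsometryEquiv R.symm
  have hΨemb : MeasurableEmbedding Ψ := measurableEmbedding_prodMap_id_linearIsometryEquiv R.symm
  have hΨcont : Continuous Ψ := continuous_id.prodMap R.symm.continuous
  have hS : ((slab E I hI : Opens (ℝ × E)) : Set (ℝ × E)) = I ×ˢ univ := rfl
  have hRmp : MeasurePreserving (R : E → E) volume volume := R.measurePreserving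
  have hRemb : MeasurableEmbedding (R : E → E) := R.toHomeomorph.measurableEmbedding
  -- images of compact subsets of the slab under `Ψ` are compact subsets of the slab
  have himg : ∀ K ⊆ ((slab E I hI : Opens (ℝ × E)) : Set (ℝ × E)), IsCompact K →
      Ψ '' K ⊆ ((slab E I hI : Opens (ℝ × E)) : Set (ℝ × E)) ∧ IsCompact (Ψ '' K) :=
    fun K hK hKc => ⟨image_prodMap_subset_slab R.symm hK, hKc.image hΨcont⟩
  -- set lower integrals over `K` of a function of `Ψ z` are integrals over `Ψ '' K`
  have hcvK : ∀ (K : Set (ℝ × E)) (Fn : ℝ × E → ℝ≥0∞),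
      ∫⁻ z in K, Fn (Ψ z) = ∫⁻ z in Ψ '' K, Fn z :=
    fun K Fn => hΨmp.setLIntegral_comp_emb hΨemb Fn K
  obtain ⟨G, hG, hG2, hloc⟩ := h.localEnergy
  refine
    { distributional := isDistributionalNSSolutionOn_conj h.distributional R
      energyClass := ?_
      pressure := ?_
      localEnergy := ⟨fun t x => (R : E →L[ℝ] E).comp ((G t (R.symm x)).comp (R.symm : E →L[ℝ] E)),
        hasWeakSpatialGradientOn_conj hG R, ?_, ?_⟩ }
  · -- `v ∈ L^∞_t L²_x` on compact sets
    intro K hK hKc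
    obtain ⟨hK'Q, hK'c⟩ := himg K hK hKc
    obtain ⟨C, hC⟩ := h.energyClass (Ψ '' K) hK'Q hK'c
    refine ⟨C, ?_⟩
    filter_upwards [hC] with t ht
    have key : ∀ y : E,
        K.indicator (fun z : ℝ × E => ‖(fun t x => R (u t (R.symm x))) z.1 z.2‖ₑ ^ 2) (t, R y) =
          (Ψ '' K).indicator (fun z : ℝ × E => ‖u z.1 z.2‖ₑ ^ 2) (t, y) := by
      intro y
      have hmem : ((t, R y) : ℝ × E) ∈ K ↔ ((t, y) : ℝ × E) ∈ Ψ '' K := by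
        constructor
        · intro hz
          refine ⟨(t, R y), hz, ?_⟩
          simp [hΨ]
        · rintro ⟨w, hw, hwe⟩
          have h1 : w.1 = t := by simpa [hΨ] using congrArg Prod.fst hwe
          have h2 : R.symm w.2 = y := by simpa [hΨ] using congrArg Prod.snd hwe
          have h3 : w = (t, R y) := by
            ext
            · exact h1
            · rw [← h2, LinearIsometryEquiv.apply_symm_apply]
          rw [← h3]; exact hw
      by_cases hz : ((t, R y) : ℝ × E) ∈ K
      · rw [indicator_of_mem hz, indicator_of_mem (hmem.1 hz)]
        simp
      · rw [indicator_of_notMem hz, indicator_of_notMem (fun h' => hz (hmem.2 h'))]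
    calc ∫⁻ x, K.indicator (fun z : ℝ × E => ‖(fun t x => R (u t (R.symm x))) z.1 z.2‖ₑ ^ 2) (t, x)
        = ∫⁻ y, K.indicator
            (fun z : ℝ × E => ‖(fun t x => R (u t (R.symm x))) z.1 z.2‖ₑ ^ 2) (t, R y) :=
          (hRmp.lintegral_comp_emb hRemb _).symm
      _ = ∫⁻ y, (Ψ '' K).indicator (fun z : ℝ × E => ‖u z.1 z.2‖ₑ ^ 2) (t, y) := by
          simp_rw [key]
      _ ≤ C := ht
  · -- `q ∈ L^{3/2}` on compact sets
    intro K hK hKc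
    obtain ⟨hK'Q, hK'c⟩ := himg K hK hKc
    have := hcvK K (fun z => ‖p z.1 z.2‖ₑ ^ (3 / 2 : ℝ))
    simp only [hΨ, Prod.map_fst, id_eq, Prod.map_snd] at this
    rw [this]
    exact h.pressure _ hK'Q hK'c
  · -- `∇v ∈ L²` on compact sets
    intro K hK hKc
    obtain ⟨hK'Q, hK'c⟩ := himg K hK hKc
    have := hcvK K (fun z => ENNReal.ofReal (frobeniusNormSq (G z.1 z.2)))
    simp only [hΨ, Prod.map_fst, id_eq, Prod.map_snd] at this
    simp only [frobeniusNormSq_conj_linearIsometryEquiv]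
    rw [this]
    exact hG2 _ hK'Q hK'c
  · -- the local energy inequality
    intro φ hφ hφ0
    set φR : ℝ → E → ℝ := fun t y => φ t (R y) with hφR
    have hφR' : IsSpaceTimeTestOn (slab E I hI) φR := isSpaceTimeTestOn_comp_lie hφ R
    have hφR0 : ∀ t y, 0 ≤ φR t y := fun t y => hφ0 t (R y)
    have key := hloc φR hφR' hφR0
    have hrepr : ∀ t, φ t = fun x => φR t (R.symm x) := by
      intro t; funext x; simp [hφR]
    -- dissipation term: substitute `x = R y`
    have hD : ∀ t, ∫ x, frobeniusNormSq
        ((fun t x => (R : E →L[ℝ] E).comp ((G t (R.symm x)).comp (R.symm : E →L[ℝ] E))) t x) *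
          φ t x = ∫ y, frobeniusNormSq (G t y) * φR t y := by
      intro t
      rw [← hRmp.integral_comp hRemb]
      refine integral_congr_ae (ae_of_all _ fun y => ?_)
      simp only [frobeniusNormSq_conj_linearIsometryEquiv, LinearIsometryEquiv.symm_apply_apply,
        hφR]
    -- right-hand side: substitute `x = R y`
    have hRHS : ∀ t, ∫ x, (‖(fun t x => R (u t (R.symm x))) t x‖ ^ 2 *
          (timeDeriv φ t x + ν * Δ (φ t) x) +
        (‖(fun t x => R (u t (R.symm x))) t x‖ ^ 2 + 2 * (fun t x => p t (R.symm x)) t x) *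
          ⟪(fun t x => R (u t (R.symm x))) t x, gradient (φ t) x⟫ +
        2 * ⟪(fun t x => R (f t (R.symm x))) t x, (fun t x => R (u t (R.symm x))) t x⟫ * φ t x) =
        ∫ y, (‖u t y‖ ^ 2 * (timeDeriv φR t y + ν * Δ (φR t) y) +
          (‖u t y‖ ^ 2 + 2 * p t y) * ⟪u t y, gradient (φR t) y⟫ +
          2 * ⟪f t y, u t y⟫ * φR t y) := by
      intro t
      rw [← hRmp.integral_comp hRemb]
      refine integral_congr_ae (ae_of_all _ fun y => ?_)
      have hlap : Δ (φ t) (R y) = Δ (φR t) y := by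
        rw [hrepr t, laplacian_comp_linearIsometryEquiv_symm, LinearIsometryEquiv.symm_apply_apply]
      have hgrad : gradient (φ t) (R y) = R (gradient (φR t) y) := by
        rw [hrepr t, gradient_comp_linearIsometryEquiv_symm, LinearIsometryEquiv.symm_apply_apply]
      have htd : timeDeriv φ t (R y) = timeDeriv φR t y := rfl
      simp only [LinearIsometryEquiv.norm_map, LinearIsometryEquiv.symm_apply_apply, hlap, hgrad,
        htd, LinearIsometryEquiv.inner_map_map]
      rfl
    simp_rw [hD, hRHS]
    exact key

end Suitable

/-! ### Assembly: `SimilarityCovariance` -/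

section Assembly

variable {u : ℝ → EuclideanSpace ℝ (Fin 3) → EuclideanSpace ℝ (Fin 3)}
  {p : ℝ → EuclideanSpace ℝ (Fin 3) → ℝ}
  {G : ℝ → EuclideanSpace ℝ (Fin 3) → EuclideanSpace ℝ (Fin 3) →L[ℝ] EuclideanSpace ℝ (Fin 3)}
  {C : ℝ}

/-- **Rotation half of `SimilarityCovariance`** for a general linear isometry `R` of `ℝ³`: the
apex class with constant `C` and the singularity of the origin pass to the conjugated field
`R u(t, R⁻¹x)`, with pressure `p(t, R⁻¹x)` and gradient `R ∘ G(t, R⁻¹x) ∘ R⁻¹`. -/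
theorem apexClass_conj
    (hsw : IsSuitableWeakSolutionOn (slab (EuclideanSpace ℝ (Fin 3)) (Iio 0) isOpen_Iio) 1 0 u p)
    (hG : HasWeakSpatialGradientOn (slab (EuclideanSpace ℝ (Fin 3)) (Iio 0) isOpen_Iio) u G)
    (hI : typeIBound (Iio (0 : ℝ) ×ˢ univ) u p G < ⊤) (hC : HasTypeIDecay C u)
    (hsing : IsBackwardSingularPoint u 0)
    (R : EuclideanSpace ℝ (Fin 3) ≃ₗᵢ[ℝ] EuclideanSpace ℝ (Fin 3)) :
    ∃ (q : ℝ → EuclideanSpace ℝ (Fin 3) → ℝ)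
      (H : ℝ → EuclideanSpace ℝ (Fin 3) → EuclideanSpace ℝ (Fin 3) →L[ℝ] EuclideanSpace ℝ (Fin 3)),
      IsSuitableWeakSolutionOn (slab (EuclideanSpace ℝ (Fin 3)) (Iio 0) isOpen_Iio) 1 0
        (fun t x => R (u t (R.symm x))) q ∧
      HasWeakSpatialGradientOn (slab (EuclideanSpace ℝ (Fin 3)) (Iio 0) isOpen_Iio)
        (fun t x => R (u t (R.symm x))) H ∧
      typeIBound (Iio (0 : ℝ) ×ˢ univ) (fun t x => R (u t (R.symm x))) q H < ⊤ ∧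
      HasTypeIDecay C (fun t x => R (u t (R.symm x))) ∧
      IsBackwardSingularPoint (fun t x => R (u t (R.symm x))) 0 := by
  have hsw' := isSuitableWeakSolutionOn_conj hsw R
  have hf : (fun t x => R ((0 : ℝ → EuclideanSpace ℝ (Fin 3) → EuclideanSpace ℝ (Fin 3)) t
      (R.symm x))) = 0 := by
    funext t x; simp
  rw [hf] at hsw'
  exact ⟨fun t x => p t (R.symm x),
    fun t x => (R : EuclideanSpace ℝ (Fin 3) →L[ℝ] EuclideanSpace ℝ (Fin 3)).comp
      ((G t (R.symm x)).comp (R.symm : EuclideanSpace ℝ (Fin 3) →L[ℝ] EuclideanSpace ℝ (Fin 3))),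
    hsw', hasWeakSpatialGradientOn_conj hG R, by rwa [LIE.typeIBound_lowerHalf_conj],
    LIE.hasTypeIDecay_conj R hC, LIE.isBackwardSingularPoint_zero_conj R hsing⟩

end Assembly

/-- **`SimilarityCovariance` holds** (item stmt-NavierStokesRegularity-11720 of route
RellichScar): the apex class — suitable weak solutions of Navier–Stokes (`ν = 1`, `f = 0`) on
`ℝ³ × (−∞, 0)` with a weak spatial gradient, `𝐈(ℝ³ × ℝ₋) < ∞` and the space–time Type-I bound
`|u| ≤ C/(|x| + √−t)` — together with the backward singularity of the origin is covariant under
the Navier–Stokes rescaling `u ↦ λu(λ²t, λx)` (`λ > 0`; pressure `λ²p(λ²t, λx)`, gradient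
`λ²G(λ²t, λx)`) and under the rotations `u ↦ R_θ u(t, R_θ⁻¹ x)` about the `x₃`-axis (pressure
`p(t, R_θ⁻¹x)`, gradient conjugated), with the same constant `C` (KNSS 2009, §1; CKN 1982, §2;
Albritton–Barker 2019, §3). -/
theorem similarityCovariance_proof :
    Summit.NavierStokesRegularity.NavierStokesRegularity.Theses.RellichScar.SimilarityCovariance :=
  by
  intro u p G C hsw hG hI hC hsing
  refine ⟨fun lam hlam => Zoom.apexClass_nsRescale hsw hG hI hC hsing hlam, fun θ => ?_⟩
  have key := apexClass_conj hsw hG hI hC hsing (rotZLIE θ)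
  simpa only [rotZLIE_apply, rotZLIE_symm_apply] using key

end Summit.NavierStokesRegularity.NavierStokesRegularity.Theorems.RellichScarSimilarityCovariance
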